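import Summits.ABC.StewartYu.RecordByNameVPrep
import Summits.ABC.StewartYu.PadicG3ParGPowG
import Summits.ABC.StewartYu.RecordGeneric
import Summits.ABC.StewartYu.RecordByName
import HarnessLib

/-!
# Cell abc-stewartyu, Gen-3 record v2 (WP-M3.R, m = 0 branch): `RecordOdd` BY NAME for the corrected
# gain-divided family `PadicG3ParV` (R1′), with the admissible constant `C m = 256^m`

`Summits/ABC/StewartYu/RecordByNameV.lean` — cell `abc-stewartyu` (HOME `run/shared/lean/pub/abc-stewartyu/`),
route `PadicPrimesKummerThird`, crux `Y07Odd` (stmt-ABC-19658), registered stub `stub_endRecordG` (record half);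
seat lp-1 (g3).  Theorems only.

Plan g8's two-branch ruling (STATUS 2026-08-27T03:23:27Z / 03:39:43Z): `m ≥ 1` is served by the v1 record
`PadicG3Par.recordOdd` (`RecordByName`, p488553); `m = 0` (the unbounded range of `p`) by the v2 family
`PadicG3ParV` (p491605) whose END facts are in `PadicG3ParVA` (p492021).  This file is ONE application of the
record-agnostic capstone `RecordExitsNumeric.recordOdd_of_facts` (`RecordGeneric`, p490748) at
* box/multiplicity scale `L := LgV` (`MV = 16(n+1)·LgV`, `S₀NV = MV/(n+2)⁴`),
* effective level-0 range `X := ⌈g⌉·XV` (the END degree bound `D₀V ≤ g·XV·LgV/4 + 2` carries the excess gain `g`;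
  the depth's `2^{lgg} ≥ ⌈g⌉` pays for it exactly: `2^{Ŝ−1}·⌈g⌉·XV ≤ 2^{ŜG−1}·XV < XsV ŜG`, `RecordByNameVPrep`),
* END degree scale `ρ := max (N_q·LV/2^{ŜG}) 1`, Siegel constant `c := C_bⁿ/g^{n−1}` (R1′), range scale `T := 2^{Ŝ−1}`
  (v1's `two_pow_mul_K_lt`, `K ≤ N_q`),
* the clause-(C) box `ρ + Amax ≤ λ(n)·LgV` from `24·C_bⁿ·Ω·K/gⁿ ≤ LgV` (`core_le_LgV`) and the ONE v2-specific
  hypothesis **`gⁿ ≤ K`** (`hgK`; at `m = 0`, `p ≥ 3`, `K₀ ≥ p − 1` it is `pow_g_le_K_of_m_zero'`, p491305),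
for EVERY END datum in the ranges `1 ≤ D₀ ≤ D₀V`, `S₀NV ≤ S₀`, `XsV ŜG ≤ 2·X_f + 1`, `1 ≤ Dⱼ ≤ DV j` — so the
frame's END slots (p2's `XfinO = ⌊2ⁿ·XsV ŜG/(2(n+1))⌋`, `S₀NV`, `D₀V`, `DV`) are served without a monotonicity step:
`recordOddV` (generic `hgK`), `recordOddV_of_m_zero`, and the END instances `recordOddV_end` / `recordOddV_end'`.

Instantiation convention (unchanged from v1, STATUS lp-1 2026-08-27T00:58:15Z): `K ≤ N_q ≤ 2ⁿ·K` (the frame sets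
`N_q := K`), `½ ≤ θ₀`, `Amax ≤ 2ⁿ·Ω`, `1 ≤ Aⱼ`.

References: Yu. V. Nesterenko, LNM 1819 (2003), §5.2 (5.12)–(5.22), Lemmas 5.3–5.4; K. Yu, Acta Math. 211 (2013), §3.1.
-/

noncomputable section

open Finset Real Nat

namespace Summit.ABC.StewartYu

namespace PadicG3Par

open Summit.ABC.StewartYu.RecordExitsNumeric
open Summit.ABC.StewartYu.GenThreeFrameSpecOdd (RecordOdd)

variable {n : ℕ} (P : PadicG3Par n)

/-- `1 ≤ Ω` under the height floor `1 ≤ Aⱼ`. [folklore] -/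
theorem one_le_Ω (hA1 : ∀ j, 1 ≤ P.A j) : (1 : ℝ) ≤ P.Ω := by
  unfold Ω
  calc (1 : ℝ) = ∏ _j : Fin n, (1 : ℝ) := by simp
    _ ≤ ∏ j, P.A j := prod_le_prod (fun _ _ => zero_le_one) fun j _ => hA1 j

/-- The clause-(C) box of the v2 family: **`24·C_bⁿ·Ω ≤ LgV`** from `24 C_bⁿ Ω K/gⁿ ≤ LgV` and `gⁿ ≤ K`.
[cite: Nesterenko2003, §5.2 (5.21)] -/
theorem core_Ω_le_LgV (hgK : P.g ^ n ≤ (P.K : ℝ)) : 24 * Cb ^ n * P.Ω ≤ P.LgV := by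
  have hcore := P.core_le_LgV
  have hg0 : 0 < P.g := lt_of_lt_of_le one_pos P.one_le_g
  have hgn : 0 < P.g ^ n := pow_pos hg0 n
  have hK : 0 < (P.K : ℝ) := P.K_pos
  have hL : (0 : ℝ) ≤ P.LgV := by positivity
  rw [div_le_iff₀ hgn] at hcore
  -- `24 Cbⁿ Ω K ≤ LgV gⁿ ≤ LgV K`
  have h1 : (P.LgV : ℝ) * P.g ^ n ≤ P.LgV * P.K := mul_le_mul_of_nonneg_left hgK hL
  have h2 : 24 * Cb ^ n * P.Ω * P.K ≤ P.LgV * P.K := hcore.trans h1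
  exact le_of_mul_le_mul_right h2 hK

/-! ### The record -/

/-- **`RecordOdd (fun m => 256^m) p n P.A P.Amax P.W D₀ S₀ X_f D` for the v2 family `PadicG3ParV`** at every END
datum `1 ≤ D₀ ≤ D₀V`, `S₀NV ≤ S₀`, `XsV ŜG ≤ 2·X_f + 1`, `1 ≤ Dⱼ ≤ DV j`, under the instantiation convention
(`K ≤ N_q ≤ 2ⁿK`, `½ ≤ θ₀`, `Amax ≤ 2ⁿΩ`, `1 ≤ Aⱼ`) and the excess-gain bound `gⁿ ≤ K`.
[cite: Nesterenko2003, §5.2 (5.12)–(5.22)] -/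
theorem recordOddV (hgK : P.g ^ n ≤ (P.K : ℝ)) (hKNq : P.K ≤ P.Nq) (hNqK : P.Nq ≤ 2 ^ n * P.K)
    (hθ : (1 / 2 : ℝ) ≤ P.θ₀) (hAmax : P.Amax ≤ 2 ^ n * P.Ω) (hA1 : ∀ j, 1 ≤ P.A j) (p : ℕ)
    {D₀ S₀ Xf : ℕ} {D : Fin n → ℕ} (hD₀1 : 1 ≤ D₀) (hD₀ : D₀ ≤ P.D0V) (hS₀ : P.S0NV ≤ S₀)
    (hXf : P.XsV P.SdG ≤ 2 * Xf + 1) (hD1 : ∀ j, 1 ≤ D j) (hD : ∀ j, D j ≤ P.DV j) :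
    RecordOdd (fun m => (256 : ℝ) ^ m) p n P.A P.Amax P.W D₀ S₀ Xf D := by
  -- positivity / floors
  have hg1 := P.one_le_g
  have hg0 : 0 < P.g := lt_of_lt_of_le one_pos hg1
  have hK1 : (1 : ℝ) ≤ P.K := by exact_mod_cast P.one_le_K
  have hΩ := P.Ω_pos
  have hΩ1 := P.one_le_Ω hA1
  have hCb64 := sixtyfour_le_Cb
  have hCb0 : (0 : ℝ) ≤ Cb := by linarith
  have hCbn : (1 : ℝ) ≤ Cb ^ n := one_le_pow₀ (by linarith)
  have hL1 := P.one_le_LgV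
  have hL0 : (0 : ℝ) ≤ P.LgV := by linarith
  have hXV := P.XV_ge_128
  have hXV0 : (0 : ℝ) ≤ P.XV := by linarith
  have hgceil1 : (1 : ℝ) ≤ P.gceil := by exact_mod_cast P.one_le_gceil
  have hggc := P.g_le_gceil
  -- `g^{n-1} ≤ gⁿ ≤ K`
  have hgn1 : 1 ≤ P.g ^ (n - 1) := one_le_pow₀ hg1
  have hgnK : P.g ^ (n - 1) ≤ (P.K : ℝ) := (pow_le_pow_right₀ hg1 (Nat.sub_le n 1)).trans hgK
  have hgnpos : 0 < P.g ^ (n - 1) := by positivity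
  -- the effective range `X = ⌈g⌉·XV`
  have hXreal : (((P.gceil * P.XV : ℕ) : ℝ)) = (P.gceil : ℝ) * P.XV := by push_cast; ring
  have hXge : (P.XV : ℝ) ≤ ((P.gceil * P.XV : ℕ) : ℝ) := by
    rw [hXreal]; exact le_mul_of_one_le_left hXV0 hgceil1
  have hXgX : P.g * P.XV ≤ ((P.gceil * P.XV : ℕ) : ℝ) := by
    rw [hXreal]; exact mul_le_mul_of_nonneg_right hggc hXV0
  have hX1 : 1 ≤ P.gceil * P.XV := Nat.mul_pos P.one_le_gceil (le_trans (by omega) P.sixtyfour_le_XV)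
  have hX1r : (1 : ℝ) ≤ ((P.gceil * P.XV : ℕ) : ℝ) := by exact_mod_cast hX1
  -- the Siegel constant `c = Cbⁿ/g^{n-1}`
  obtain ⟨c, hc⟩ : ∃ c : ℝ, c = Cb ^ n / P.g ^ (n - 1) := ⟨_, rfl⟩
  have hc0 : 0 ≤ c := by rw [hc]; positivity
  have hcle : c ≤ Cb ^ n := by rw [hc]; exact div_le_self (by positivity) hgn1
  have hc87 : c ≤ (87 : ℝ) ^ n := hcle.trans (pow_le_pow_left₀ hCb0 Cb_le n)
  have hcΩK : c * P.Ω * P.K = Cb ^ n * P.Ω * P.K / P.g ^ (n - 1) := by rw [hc]; field_simp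
  -- `c·Ω·K = C_bⁿ Ω (K/g^{n-1}) ≥ C_bⁿ·Ω ≥ 1`
  have hcΩK1 : (1 : ℝ) ≤ c * P.Ω * P.K := by
    rw [hcΩK, le_div_iff₀ hgnpos, one_mul]
    have h1 : (1 : ℝ) ≤ Cb ^ n * P.Ω := one_le_mul_of_one_le_of_one_le hCbn hΩ1
    calc P.g ^ (n - 1) ≤ P.K := hgnK
      _ = 1 * P.K := (one_mul _).symm
      _ ≤ Cb ^ n * P.Ω * P.K := mul_le_mul_of_nonneg_right h1 (by linarith)
  have hXcΩK1 : (1 : ℝ) ≤ ((P.gceil * P.XV : ℕ) : ℝ) * (c * P.Ω * P.K) :=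
    one_le_mul_of_one_le_of_one_le hX1r hcΩK1
  -- range facts, `T := 2^{Ŝ-1}`
  obtain ⟨hXf1, hXf2⟩ := P.range_facts hXf
  have hKT : (2 : ℝ) ^ (n + 22) * P.K < ((2 ^ (P.Sdepth - 1) : ℕ) : ℝ) := by
    exact_mod_cast P.two_pow_mul_K_lt hKNq
  have h23 : (2 : ℝ) ^ (n + 23) ≤ ((2 ^ (P.Sdepth - 1) : ℕ) : ℝ) := by
    exact_mod_cast P.two_pow_le_two_pow_Sdepth_pred
  have hxfT : ((2 ^ (P.Sdepth - 1) : ℕ) : ℝ) * ((P.gceil * P.XV : ℕ) : ℝ) < 2 * (Xf : ℝ) + 1 := by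
    exact_mod_cast hXf2
  -- the END degree scale `ρ = max ρ₀ 1`
  obtain ⟨ρ₀, hρ₀⟩ : ∃ ρ₀ : ℝ, ρ₀ = (P.Nq : ℝ) * P.LV / 2 ^ P.SdG := ⟨_, rfl⟩
  have hρ₀lt : ρ₀ < (P.LgV : ℝ) / 2 ^ (n + 23) := by rw [hρ₀]; exact P.rhoV_lt
  have hρ1 : (1 : ℝ) ≤ max ρ₀ 1 := le_max_right _ _
  have hρ₀le : ρ₀ ≤ max ρ₀ 1 := le_max_left _ _
  have hone : (1 : ℝ) < (P.LgV : ℝ) / 2 ^ (n + 23) := by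
    have hL : (2 : ℝ) ^ (n + 25) ≤ P.LgV := by exact_mod_cast P.two_pow_le_LgV
    have hlt : (2 : ℝ) ^ (n + 23) < 2 ^ (n + 25) := pow_lt_pow_right₀ (by norm_num) (by omega)
    rw [lt_div_iff₀ (by positivity), one_mul]
    linarith
  have hρlt : max ρ₀ 1 < (P.LgV : ℝ) / 2 ^ (n + 23) := max_lt hρ₀lt hone
  have hDρ : ∀ j, (D j : ℝ) ≤ max ρ₀ 1 / P.A j + 1 := by
    intro j
    have hA := P.A_pos j
    have h1 : (D j : ℝ) ≤ P.DV j := by exact_mod_cast hD j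
    have h2 := P.DV_le_rhoV_div j
    rw [← hρ₀] at h2
    have h3 : ρ₀ / P.A j ≤ max ρ₀ 1 / P.A j := div_le_div_of_nonneg_right hρ₀le hA.le
    linarith
  -- the box of clause (C)
  have h24 := P.core_Ω_le_LgV hgK
  have hΛL : max ρ₀ 1 + P.Amax ≤ (((2 : ℝ) ^ (n + 23))⁻¹ + 2 ^ n / (24 * Cb ^ n)) * P.LgV := by
    have h1 : max ρ₀ 1 ≤ ((2 : ℝ) ^ (n + 23))⁻¹ * P.LgV := by
      rw [inv_mul_eq_div]; exact hρlt.le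
    have h2 : P.Amax ≤ 2 ^ n / (24 * Cb ^ n) * P.LgV := by
      have hCbn0 : (0 : ℝ) < 24 * Cb ^ n := by positivity
      calc P.Amax ≤ 2 ^ n * P.Ω := hAmax
        _ = 2 ^ n / (24 * Cb ^ n) * (24 * Cb ^ n * P.Ω) := by field_simp
        _ ≤ 2 ^ n / (24 * Cb ^ n) * P.LgV := mul_le_mul_of_nonneg_left h24 (by positivity)
    have e : (((2 : ℝ) ^ (n + 23))⁻¹ + 2 ^ n / (24 * Cb ^ n)) * P.LgV =
        ((2 : ℝ) ^ (n + 23))⁻¹ * P.LgV + 2 ^ n / (24 * Cb ^ n) * P.LgV := by ring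
    rw [e]; linarith
  -- `LgV ≤ (264 Cbⁿ + 2^{2n+26}) K Ω`
  have hgK' : P.g ≤ (P.K : ℝ) := by
    have : P.g ≤ P.g ^ n := le_self_pow₀ hg1 (by have := P.hn; omega)
    linarith
  have hLKΩ : (P.LgV : ℝ) ≤ (264 * Cb ^ n + 2 ^ (2 * n + 26)) * P.K * ∏ j, P.A j :=
    P.LgV_le_KΩ hθ hNqK hAmax hA1 hgK'
  -- exit B scalars
  have hcore0 : 0 < Cb ^ n * P.Ω * P.K := by positivity
  have eΩ : c * (∏ j, P.A j) * P.K = c * P.Ω * P.K := rfl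
  have h3L : (3 / 2 : ℝ) * (n + 1) * P.LgV ≤ ((P.gceil * P.XV : ℕ) : ℝ) * (c * (∏ j, P.A j) * P.K) := by
    have hXE := P.XE_le_XV
    rw [div_le_iff₀ hcore0] at hXE
    rw [eΩ, hcΩK, mul_div_assoc', le_div_iff₀ hgnpos]
    calc (3 / 2 : ℝ) * (n + 1) * P.LgV * P.g ^ (n - 1) ≤ P.XV * (Cb ^ n * P.Ω * P.K) := hXE
      _ ≤ ((P.gceil * P.XV : ℕ) : ℝ) * (Cb ^ n * P.Ω * P.K) := mul_le_mul_of_nonneg_right hXge hcore0.le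
  have hD₀8 : (D₀ : ℝ) ≤ 8 * ((P.gceil * P.XV : ℕ) : ℝ) * (c * (∏ j, P.A j) * P.K) := by
    have h1 : (D₀ : ℝ) ≤ P.D0V := by exact_mod_cast hD₀
    have h2 : (P.D0V : ℝ) < 6 * P.XV * (Cb ^ n * P.Ω * P.K / P.g ^ (n - 1)) + 2 := by
      have h := P.L0V_lt
      have e : 6 * (P.XV : ℝ) * Cb ^ n * P.Ω * P.K / P.g ^ (n - 1) =
          6 * P.XV * (Cb ^ n * P.Ω * P.K / P.g ^ (n - 1)) := by field_simp
      unfold D0V; push_cast; linarith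
    rw [eΩ]
    rw [← hcΩK] at h2
    have hq : 0 ≤ c * P.Ω * P.K := by linarith
    have h5 : (P.XV : ℝ) * (c * P.Ω * P.K) ≤ ((P.gceil * P.XV : ℕ) : ℝ) * (c * P.Ω * P.K) :=
      mul_le_mul_of_nonneg_right hXge hq
    linarith [hXcΩK1, h5, h1, h2]
  have hD₀q : (D₀ : ℝ) ≤ ((P.gceil * P.XV : ℕ) : ℝ) * P.LgV / 4 + 2 := by
    have h1 : (D₀ : ℝ) ≤ P.D0V := by exact_mod_cast hD₀
    have h2 := P.D0V_le'
    have h3 : P.g * P.XV * P.LgV ≤ ((P.gceil * P.XV : ℕ) : ℝ) * P.LgV :=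
      mul_le_mul_of_nonneg_right hXgX hL0
    linarith
  have hS : 16 * (n + 1) * P.LgV < (S₀ + 1) * (n + 2) ^ 4 :=
    lt_of_lt_of_le P.MV_lt_S0NV_succ_mul (Nat.mul_le_mul_right _ (by omega))
  have hL24 : 2 ^ (n + 24) ≤ P.LgV :=
    le_trans (Nat.pow_le_pow_right (by norm_num) (by omega)) P.two_pow_le_LgV
  exact recordOdd_of_facts P.hn hA1 P.hAmax P.hAmax1 P.hW p (pow256_admissible n).1
    (pow256_admissible n).2 hX1 hL24 hD₀1 hD₀q hXf1 hS hD1 hDρ hρ1 hρlt hK1 hc0 hc87 h3L hD₀8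
    h23 hxfT hKT hΛL hLKΩ

/-- **The v2 record at `m = 0`** (`p ≥ 3`, `K₀ ≥ p − 1`: then `gⁿ ≤ K` by `pow_g_le_K_of_m_zero'`).
[cite: Nesterenko2003, §5.2 (5.12)–(5.22)] -/
theorem recordOddV_of_m_zero (hm : P.m = 0) (hp3 : 3 ≤ P.p) (hK₀ : (P.p : ℝ) - 1 ≤ P.K₀)
    (hKNq : P.K ≤ P.Nq) (hNqK : P.Nq ≤ 2 ^ n * P.K) (hθ : (1 / 2 : ℝ) ≤ P.θ₀)
    (hAmax : P.Amax ≤ 2 ^ n * P.Ω) (hA1 : ∀ j, 1 ≤ P.A j) (p : ℕ)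
    {D₀ S₀ Xf : ℕ} {D : Fin n → ℕ} (hD₀1 : 1 ≤ D₀) (hD₀ : D₀ ≤ P.D0V) (hS₀ : P.S0NV ≤ S₀)
    (hXf : P.XsV P.SdG ≤ 2 * Xf + 1) (hD1 : ∀ j, 1 ≤ D j) (hD : ∀ j, D j ≤ P.DV j) :
    RecordOdd (fun m => (256 : ℝ) ^ m) p n P.A P.Amax P.W D₀ S₀ Xf D :=
  P.recordOddV (P.pow_g_le_K_of_m_zero' hm hp3 hK₀) hKNq hNqK hθ hAmax hA1 p hD₀1 hD₀ hS₀ hXf hD1 hD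

/-! ### The END instances (the frame's slots `XfinO = ⌊2ⁿ XsV ŜG/(2(n+1))⌋`, `S₀NV`, `D₀V`, `DV`) -/

/-- **The v2 record at the frame's END slots** under the generic excess-gain hypothesis `gⁿ ≤ K`:
`RecordOdd (256^·) p n P.A P.Amax P.W D₀V S₀NV ⌊2ⁿ·XsV ŜG/(2(n+1))⌋ DV`. [cite: Nesterenko2003, §5.2 (5.12)–(5.22)] -/
theorem recordOddV_end' (hgK : P.g ^ n ≤ (P.K : ℝ)) (hKNq : P.K ≤ P.Nq) (hNqK : P.Nq ≤ 2 ^ n * P.K)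
    (hθ : (1 / 2 : ℝ) ≤ P.θ₀) (hAmax : P.Amax ≤ 2 ^ n * P.Ω) (hA1 : ∀ j, 1 ≤ P.A j) (p : ℕ) :
    RecordOdd (fun m => (256 : ℝ) ^ m) p n P.A P.Amax P.W P.D0V P.S0NV
      (2 ^ n * P.XsV P.SdG / (2 * (n + 1))) P.DV :=
  P.recordOddV hgK hKNq hNqK hθ hAmax hA1 p P.one_le_D0V le_rfl le_rfl
    P.XsV_SdG_le_two_mul_add_one P.one_le_DV (fun _ => le_rfl)

/-- **The v2 record at the frame's END slots, `m = 0`** (`p ≥ 3`, `K₀ ≥ p − 1`):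
`RecordOdd (256^·) p n P.A P.Amax P.W D₀V S₀NV ⌊2ⁿ·XsV ŜG/(2(n+1))⌋ DV`. [cite: Nesterenko2003, §5.2 (5.12)–(5.22)] -/
theorem recordOddV_end (hm : P.m = 0) (hp3 : 3 ≤ P.p) (hK₀ : (P.p : ℝ) - 1 ≤ P.K₀)
    (hKNq : P.K ≤ P.Nq) (hNqK : P.Nq ≤ 2 ^ n * P.K) (hθ : (1 / 2 : ℝ) ≤ P.θ₀)
    (hAmax : P.Amax ≤ 2 ^ n * P.Ω) (hA1 : ∀ j, 1 ≤ P.A j) (p : ℕ) :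
    RecordOdd (fun m => (256 : ℝ) ^ m) p n P.A P.Amax P.W P.D0V P.S0NV
      (2 ^ n * P.XsV P.SdG / (2 * (n + 1))) P.DV :=
  P.recordOddV_end' (P.pow_g_le_K_of_m_zero' hm hp3 hK₀) hKNq hNqK hθ hAmax hA1 p

end PadicG3Par

end Summit.ABC.StewartYu

end
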